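import Summits.QuantumFields.YangMills.Theorems.BalabanUVNodesN09TowerOfNumericsRunFree
import Literature.MathematicalPhysics.QuantumFieldTheory.Balaban1983to89.Node00.Record13NumericsOfThm1CCMWZB

/-!
# BalabanUVNodes ∕ N09 — ROAD A′'s TOWER AT THE WITNESS FAMILY `θ₁₅ᶜᶜᴹ(j; γ; εbg, ε₀, ε₂₉; B₃, B₃′, a₀, a₁; Efl, logz)` (DEF-1 Z3, p646340): N09's analytic inclusion `hreg_j` and
# (F3)_j for all `j < K` from NINE CLOSED-FORM INEQUALITIES ON THE FAMILY'S FREE LETTERS `(a₀, ε₂₉, ε₀; F.L, N)` + [B11]-existence + N07's `hcrit` + (H-U); the letter row is inhabited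

Cell `pub-ymgap` (YM-PLAN Track A), width seat `pub-ymgap-dag-n09-w4` g6 (FILE 4 = INTENT-4); count-neutral helper of K1⁹ `StabilityBRunRowsAtRecordR13SepCoPHV` =
stmt-QuantumFields-27364 (`--supports`, `--as helper`).  [I] = [Balaban1987RG1] (CMP 109).

WHY.  FILE 3 `…N09TowerOfNumericsRunFree` turned the numeric hypotheses of road A′'s `α`-free tower into nine closed forms in `(εreg, ε₂₉, ε₀; F.L, N)` read at an ABSTRACT Stage-13
parameter `θ₀`.  ym-nodeO DEF-1 g10's «Z3» εbg-LETTER EDITION of the K0 witness family (`Node00/Record13NumericsOfThm1CCMWZB.lean`, p646340 ✓, answering this seat's numerics ASK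
pub-ymgap INBOX l.39916 ∕ l.39931) exposes every numerics letter of the witness as a `rfl` face: `ν.εreg = a₀`, `ν.ε₀ = ε₀`, `ε₂₉ = ε₂₉`, `εbg = εbg` (`theta13OfThm1CCMWZB_εreg ∕ _ε₀ ∕ _ε₂₉ ∕ _εbg`).
THIS FILE reads FILE 2's `α`-free tower AT THAT FAMILY: the nine closed forms become inequalities on the LETTERS `a₀ ε₂₉ ε₀` (and `F.L`, `N`), which the K0 witness pickers meet by CHOICE
(§2: the row is inhabited for every `L` and `N` — `closedFormNumerics_inhabited`), leaving at the witness exactly [B11]-existence `hsolν` on the domains, N07's `hcrit` and (H-U) `hU` at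
radius `a₀`.  The Theorem-3 DOORS (Stage-13 H-parameters + provisos + world) are not instantiated here: the H-witness of record over this family is the K0∕K1 assembly lanes' term; at any
`θ : Stage13HParams` with `θ.toStage13Params = theta13OfThm1CCMWZB …` FILE 3's `∀ P` doors apply with the same letter row by the same faces.

WHAT IS PROVED (theorems only; 0 def, 0 instance, 0 notation, 0 sorry).  §1 ★★★ `hreg_pos_all_at_theta13OfThm1CCMWZB` (road A′'s `hreg_j ∧ (F3)_j ∀ j < K` at the Z3 family, any
torus `K`, any history `g`, from the letter row + `hsolν hU hcrit`) · §2 ★ `letterRow_inhabited` (for every `F`, `N`: some `a₀, ε₂₉, ε₀ > 0` meet the nine letter inequalities — FILE 3's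
`closedFormNumerics_inhabited` at `δ_N`, `δ_Fed`) · `letterRow_inhabited_with_εbg` (the same with `εbg := a₀`, DEF-1's print-regime member: `ν.εreg ≤ εbg ≤ a₀` by `le_rfl`, and the
`huniq`-free doors' `εbg`-rows `36608·εbg ≤ 1∕3`, `64L²·εbg ≤ δ_N`, `2εbg ≤ ε₀L²` included).

HONEST FRAMING.  A COMPOSITION BY NAME (count-neutral) over DEF-1's definition file; nothing of Bałaban's estimates asserted; the letter row is exhibited INHABITED in isolation — whether
the K0 witness pickers' choice of `(a₀, ε₂₉, ε₀, εbg)` meets it JOINTLY with the other nodes' rows is the K0-numerics lane's question, not answered here; `hsolν hU hcrit` at the witness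
are N07's ∕ the (2.3) re-point's letters, DISPLAYED; `hreg` at the witness NOT discharged; N09 NOT discharged; conjunct 1 (Lemma 4) ∕ FLAG №7 untouched; K0⁷ ∕ K1⁹ ∕ K3⁸ NOT closed;
counts unmoved (typed 28∕28 · discharged 5∕28); no summit statement is proved here; one finite four-torus programme at fixed `ε = L^{−K}` per run — R4 closes the conditional rung
`BalabanLadder.UV` only; NOT continuum ∕ ℝ⁴ ∕ infinite volume ∕ OS; the Yang–Mills mass gap (Clay) is NOT proved by any of this.
-/

noncomputable section

namespace Summit.QuantumFields.YangMills.BalabanUVNodes.N09TowerOfNumericsAtThm1CCMWZB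

open MeasureTheory Set Function Filter Topology
open scoped ENNReal NNReal
open Literature.MathematicalPhysics.QuantumFieldTheory.Balaban1983to89
open Literature.MathematicalPhysics.QuantumFieldTheory.Balaban1983to89.T4Continuum (T4Family)
open Literature.MathematicalPhysics.QuantumFieldTheory.Balaban1983to89.Node00
open Literature.MathematicalPhysics.QuantumFieldTheory.Balaban1983to89.ExpMeanLog (deltaSU deltaSU_pos)
open Literature.MathematicalPhysics.QuantumFieldTheory.Balaban1983to89.FederbushMean (deltaFed deltaFed_pos)
open N09TowerOfNumericsAlphaFree (hreg_pos_all_of_hsolν_of_numerics_alphaFree)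
open N09TowerOfNumericsRunFree (numericsP_of_closedForm closedFormNumerics_inhabited)

/-! ## §1  The tower at the Z3 family, on its letters -/

section Tower

variable (F : T4Family) (N : ℕ) [NeZero N] (j : ℕ) (γ εbg ε₀ ε₂₉ B₃ B₃' a₀ a₁ : ℝ) (Efl logz : B12.RunParams → ℕ → ℝ)

/-- ★★★ **ROAD A′'s (F1) TOWER AT THE Z3 WITNESS FAMILY, ON ITS LETTERS.**  At `θ₀ := theta13OfThm1CCMWZB F N j γ εbg ε₀ ε₂₉ B₃ B₃' a₀ a₁ Efl logz` (any torus `K`, any history `g`):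
from the LETTER ROW `36608·a₀ ≤ 1∕3` · `64L²·a₀ ≤ δ_N` · `1640(12L·ε₂₉ + 18·a₀)L⁶ ≤ 1` · `13(12L·ε₂₉ + 18·a₀)L³ < δ_N` · `2a₀∕L² + 240L⁴·ε₂₉ ≤ ε₀` · `9L²·ε₀ < 1∕24` · `576L²·ε₀ < δ_N` ·
`1413L⁵·ε₀ < 1` · `4L²·ε₀ < δ_Fed` (`L = F.L`; `0 < a₀`, `0 < ε₂₉`, `0 ≤ ε₀`) + [B11]-existence `hsolν` on the domains, (H-U) `hU` and N07's `hcrit` at radius `a₀`: for every `j' < K`,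
`domAlt_{j'+1} ⊆ regSetOfRecord K j' ρ_{j'}` (N09's `hreg`) and `T_{j'}ρ_{j'} > 0` on `domAlt_{j'+1}` ((F3)).  FILE 2's `α`-free tower + FILE 3's closed forms + DEF-1's `rfl` faces.
CONDITIONAL; nothing of Bałaban's estimates asserted; `hreg` NOT discharged at the witness.
[cite: Balaban1987RG1, p.259, (0.4) p.253, (0.19) p.255, (2.9)–(2.10) pp.266–267; Balaban1985Variational, Thm 1 (8)–(10) p.279; Balaban1985Averaging, Prop. 2 (53) p.26] -/
theorem hreg_pos_all_at_theta13OfThm1CCMWZB (K : ℕ) (g : ℕ → ℝ) (ha₀ : 0 < a₀) (hε29 : 0 < ε₂₉) (hε₀ : 0 ≤ ε₀)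
    (c3 : 36608 * a₀ ≤ 1 / 3) (c2 : 64 * (F.L : ℝ) ^ 2 * a₀ ≤ deltaSU (Fin N))
    (cn1 : 1640 * (12 * (F.L : ℝ) * ε₂₉ + 18 * a₀) * (F.L : ℝ) ^ 6 ≤ 1)
    (cn2 : 13 * (12 * (F.L : ℝ) * ε₂₉ + 18 * a₀) * (F.L : ℝ) ^ 3 < deltaSU (Fin N))
    (cord : 2 * a₀ / (F.L : ℝ) ^ 2 + 240 * (F.L : ℝ) ^ 4 * ε₂₉ ≤ ε₀)
    (c24 : 9 * (F.L : ℝ) ^ 2 * ε₀ < 1 / 24) (c64 : 576 * (F.L : ℝ) ^ 2 * ε₀ < deltaSU (Fin N)) (cL : 1413 * (F.L : ℝ) ^ 5 * ε₀ < 1)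
    (cF : 4 * (F.L : ℝ) ^ 2 * ε₀ < deltaFed (Fin N))
    (hsolν : ∀ j' < K, ∀ W ∈ domAltOfRecord F N (theta13OfThm1CCMWZB F N j γ εbg ε₀ ε₂₉ B₃ B₃' a₀ a₁ Efl logz).ν K (j' + 1), UkExists F N K (j' + 1) a₀ W)
    (hU : ∀ k, Measurable (Uk F N K (k + 1) a₀))
    (hcrit : ∀ j' < K, ContinuousOn (critCfgOfRecord F N (theta13OfThm1CCMWZB F N j γ εbg ε₀ ε₂₉ B₃ B₃' a₀ a₁ Efl logz).ν K j')
      (domAltOfRecord F N (theta13OfThm1CCMWZB F N j γ εbg ε₀ ε₂₉ B₃ B₃' a₀ a₁ Efl logz).ν K (j' + 1))) :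
    ∀ j' < K, domAltOfRecord F N (theta13OfThm1CCMWZB F N j γ εbg ε₀ ε₂₉ B₃ B₃' a₀ a₁ Efl logz).ν K (j' + 1) ⊆ regSetOfRecord F N K j'
        (betaInputOfRecord F N (TcanOfRecord F N) (chiFixed29 F N (theta13OfThm1CCMWZB F N j γ εbg ε₀ ε₂₉ B₃ B₃' a₀ a₁ Efl logz).ν ε₂₉) K g j') ∧
      ∀ V ∈ domAltOfRecord F N (theta13OfThm1CCMWZB F N j γ εbg ε₀ ε₂₉ B₃ B₃' a₀ a₁ Efl logz).ν K (j' + 1),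
        0 < TcanOfRecord F N K j' (betaInputOfRecord F N (TcanOfRecord F N) (chiFixed29 F N (theta13OfThm1CCMWZB F N j γ εbg ε₀ ε₂₉ B₃ B₃' a₀ a₁ Efl logz).ν ε₂₉) K g j') V := by
  obtain ⟨hε3, hε2, hn1, hn2, hord, h24, h64, hL, hnumF⟩ :=
    numericsP_of_closedForm F K (εreg := a₀) (ε29 := ε₂₉) (ε₀ := ε₀) (δ := deltaSU (Fin N)) (δF := deltaFed (Fin N)) hε29.le c3 c2 cn1 cn2 cord c24 c64 cL cF
  exact hreg_pos_all_of_hsolν_of_numerics_alphaFree (theta13OfThm1CCMWZB F N j γ εbg ε₀ ε₂₉ B₃ B₃' a₀ a₁ Efl logz) K g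
    ha₀ hε3 hε2 hε29 hn1 hn2 hord hε₀ h24 h64 hL hnumF hsolν hU hcrit

end Tower

/-! ## §2  The letter row is inhabited -/

/-- ★ **A6 — THE LETTER ROW OF §1 IS INHABITED** for every family `F` and every `N ≥ 1`: some `a₀, ε₂₉, ε₀ > 0` meet the nine letter inequalities (FILE 3's
`closedFormNumerics_inhabited` at `δ := δ_N`, `δF := δ_Fed`).  Says NOTHING about the joint choice with the other nodes' rows. [cite: Balaban1987RG1, (0.19) p.255 and (2.9)–(2.10) pp.266–267 (bookkeeping)] -/
theorem letterRow_inhabited (F : T4Family) (N : ℕ) [NeZero N] :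
    ∃ a₀ ε₂₉ ε₀ : ℝ, 0 < a₀ ∧ 0 < ε₂₉ ∧ 0 < ε₀ ∧
      36608 * a₀ ≤ 1 / 3 ∧ 64 * (F.L : ℝ) ^ 2 * a₀ ≤ deltaSU (Fin N) ∧
      1640 * (12 * (F.L : ℝ) * ε₂₉ + 18 * a₀) * (F.L : ℝ) ^ 6 ≤ 1 ∧ 13 * (12 * (F.L : ℝ) * ε₂₉ + 18 * a₀) * (F.L : ℝ) ^ 3 < deltaSU (Fin N) ∧
      2 * a₀ / (F.L : ℝ) ^ 2 + 240 * (F.L : ℝ) ^ 4 * ε₂₉ ≤ ε₀ ∧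
      9 * (F.L : ℝ) ^ 2 * ε₀ < 1 / 24 ∧ 576 * (F.L : ℝ) ^ 2 * ε₀ < deltaSU (Fin N) ∧ 1413 * (F.L : ℝ) ^ 5 * ε₀ < 1 ∧ 4 * (F.L : ℝ) ^ 2 * ε₀ < deltaFed (Fin N) :=
  closedFormNumerics_inhabited F.L (deltaSU_pos (n := Fin N)) (deltaFed_pos (n := Fin N))

/-- **… and with the `εbg`-letter at DEF-1's print-regime member `εbg := a₀`**: the same letters also meet `a₀ ≤ εbg` (two radii, `le_rfl`) and the `huniq`-free doors' three `εbg`-rows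
`36608·εbg ≤ 1∕3`, `64L²·εbg ≤ δ_N`, `2εbg ≤ ε₀·L²` (the last from the threshold ordering, `1 ≤ L`). [cite: Balaban1987RG1, (1.1)–(1.2) p.260 and (2.9) p.266 (bookkeeping)] -/
theorem letterRow_inhabited_with_εbg (F : T4Family) (N : ℕ) [NeZero N] :
    ∃ a₀ εbg ε₂₉ ε₀ : ℝ, 0 < a₀ ∧ a₀ ≤ εbg ∧ 0 < ε₂₉ ∧ 0 < ε₀ ∧
      36608 * εbg ≤ 1 / 3 ∧ 64 * (F.L : ℝ) ^ 2 * εbg ≤ deltaSU (Fin N) ∧ 2 * εbg ≤ ε₀ * (F.L : ℝ) ^ 2 ∧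
      1640 * (12 * (F.L : ℝ) * ε₂₉ + 18 * a₀) * (F.L : ℝ) ^ 6 ≤ 1 ∧ 13 * (12 * (F.L : ℝ) * ε₂₉ + 18 * a₀) * (F.L : ℝ) ^ 3 < deltaSU (Fin N) ∧
      2 * a₀ / (F.L : ℝ) ^ 2 + 240 * (F.L : ℝ) ^ 4 * ε₂₉ ≤ ε₀ ∧
      9 * (F.L : ℝ) ^ 2 * ε₀ < 1 / 24 ∧ 576 * (F.L : ℝ) ^ 2 * ε₀ < deltaSU (Fin N) ∧ 1413 * (F.L : ℝ) ^ 5 * ε₀ < 1 ∧ 4 * (F.L : ℝ) ^ 2 * ε₀ < deltaFed (Fin N) := by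
  obtain ⟨a₀, ε₂₉, ε₀, ha₀, hε29, hε₀, c3, c2, cn1, cn2, cord, c24, c64, cL, cF⟩ := letterRow_inhabited F N
  have hL1 : (1 : ℝ) ≤ F.L := by exact_mod_cast F.hL.2.le
  have hL2 : (0 : ℝ) < (F.L : ℝ) ^ 2 := by positivity
  refine ⟨a₀, a₀, ε₂₉, ε₀, ha₀, le_rfl, hε29, hε₀, c3, c2, ?_, cn1, cn2, cord, c24, c64, cL, cF⟩
  -- `2a₀ ≤ ε₀L²` from `2a₀∕L² ≤ ε₀` (drop the non-negative `ε₂₉`-term of the ordering)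
  have h1 : 2 * a₀ / (F.L : ℝ) ^ 2 ≤ ε₀ := by
    have : 0 ≤ 240 * (F.L : ℝ) ^ 4 * ε₂₉ := by positivity
    linarith
  rw [div_le_iff₀ hL2] at h1
  exact h1

end Summit.QuantumFields.YangMills.BalabanUVNodes.N09TowerOfNumericsAtThm1CCMWZB

end
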